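import Mathlib.Data.ZMod.Basic
import Mathlib.Logic.Equiv.Fin.Basic
import Literature.Computability.Complexity.Promise
import Literature.InformationTheory.Entropy.MapEntropy
import HarnessLib

/-!
# Polynomial Entropy Approximation (`PEA`) and Polynomial Entropy Difference (`PED`) over `F₂`

The promise problems of Dvir–Gutfreund–Rothblum–Vadhan [DGRV, §3]: given a polynomial map
`p = (p₁, …, p_m) : F₂ⁿ → F₂^m` of degree `≤ d` (and, for `PEA`, a threshold `k`), compare the
Shannon entropy `H(p(U_n))` in bits of the output on a uniform input with `k` (`PEA`), resp. with
the entropy of a second map `q` (`PED`).  `PED_{F₂,3}` (additive gap `1`) is `SZKP_L`-complete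
[DGRV, Thm 1.1 / 4.7]; `PEA` and `PED` are inter-reducible up to the gap convention [DGRV, §3 p. 6].

## Contents

* `PolyMapF2 n` — the SPARSE presentation of a polynomial map `F₂ⁿ → F₂^m` fixed by route
  PneNP/SzkEntropy: a list of `m` output polynomials, each a list of monomials, each monomial a
  list of variable indices, its value at `x ∈ F₂ⁿ` the product of the listed coordinates (empty
  monomial = `1`; repetitions collapse since `xᵢ² = xᵢ` on `F₂`-points); `PolyMapF2.eval`, the
  syntactic degree bound `PolyMapF2.DegLE d`, the output entropy `PolyMapF2.entropy P = H(P(U_n))`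
  (via `Literature.InformationTheory.Entropy.mapEntropy`, Mathlib-only), `PolyMapF2.encoding`, and the direct
  product `PolyMapF2.prod` with `entropy_prod : H(P × Q) = H(P) + H(Q)` [DGRV, §3 p. 6].
* General entropy rules used for this, now proved in
  `Literature/InformationTheory/Entropy/MapEntropy.lean` and kept here as aliases under their old
  names: `mapEntropy_comp_of_injOn` (post-composition with a map injective on outputs, e.g. output
  translations / invertible affine maps), `mapEntropy_univ_comp_equiv` (re-indexing the sample
  space), `mapEntropy_product` (additivity on independent pairs), `mapEntropy_of_injective`,
  `mapEntropy_const`.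
* `PEAInst = Σ n, PolyMapF2 n × ℕ`, `PEAInst.encoding`, `PEA d : PromiseProblem` (yes:
  `DegLE d ∧ H ≥ k + 1`; no: `DegLE d ∧ H ≤ k`); `PEDInst`, `PEDInst.encoding`, `PED d` (yes:
  `H(p) ≥ H(q) + 1`; no: `H(p) + 1 ≤ H(q)`) [DGRV, Def 3.1–3.2]; unfolding lemmas, disjointness,
  monotonicity in `d`.

## Design choices / deviations from print

* `PEA d` is BY DESIGN definitionally equal (`Iff.rfl`, checked against rev 0 of
  `Summits/PneNP/PneNP/Theses/SzkEntropy.lean`) to the `let PEA := …` inlined in every item of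
  route PneNP/SzkEntropy: same encoding, same sets.  Do not refactor the bodies of
  `PolyMapF2.eval/DegLE/entropy/encoding`, `PEAInst.encoding`, `PEA`.
* Import cone (route PneNP/SzkEntropy rev 2, 2026-08-15): this file imports the Mathlib-only
  `Literature.InformationTheory.Entropy.MapEntropy` for `mapEntropy`/`fiber` and NOT
  `Literature/Computability/Cryptography/LiuPassCondEPPRG.lean` (whose import closure carries the
  open cryptographic named facts `OWFExist`, `PRGExist`, …); the two `mapEntropy`s have the same
  body and are definitionally equal.
* Gap convention.  Print [DGRV, §3 p. 6]: YES `= {(p,k) : H(P) ≥ k + c}`, NO `= {(p,k) : H(P) ≤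
  k - c}` for a real threshold `k` (default `c = 1`, Shannon entropy on both sides).  The route
  fixes INTEGER thresholds `k` with YES `H ≥ k + 1`, NO `H ≤ k` (gap `1` at integer thresholds, as
  for `Entropy Approximation` in the SZK literature [Goldreich–Sahai–Vadhan 1999]), i.e. print's
  `PEA^{+1/2}_{F₂,d}` at the threshold `k + 1/2`; additive-constant gap conventions are
  inter-reducible by direct products `p ↦ pᵗ`, `H(Pᵗ) = t · H(P)` [DGRV, §3 p. 6] (`entropy_prod`).
* Degree.  Print's `polynomials_{F₂,d}` = maps whose coordinates have degree `≤ d`; `DegLE d` is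
  the syntactic bound on the sparse presentation.  As functions on `F₂ⁿ` these classes coincide
  (multilinearise), so the instance sets agree with print up to presentation.
* Input size.  Print gives `p` densely (`m · poly(n)` coefficients); the sparse presentation with
  `n`, `k` in binary is polynomially equivalent for fixed `d` after renaming away unused variables,
  so membership of `PEA d` in polynomial-time classes does not depend on it (not proved here).
* Not here: `MvPolynomial` semantics, Rényi/min/max-entropy variants, multiplicative/exponential
  gaps, the classes `SZKP_L`/`NISZK_L`, the reductions `PEA ≤ PED ≤ PEA`.

## References

* Z. Dvir, D. Gutfreund, G. N. Rothblum, S. Vadhan, *On approximating the entropy of polynomial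
  mappings*, ECCC TR10-160 (2010) / ICS 2011: §2 Def 2.1; §3 Def 3.1, Def 3.2 and the `PEA`
  paragraph (printed pp. 5–6 = PDF pp. 6–7); Thm 1.1, Thm 4.7.  bib `DvirGutfreundRothblumVadhan2010`.
* O. Goldreich, S. Vadhan, CCC 1999 (`ED`); O. Goldreich, A. Sahai, S. Vadhan, CRYPTO 1999 (`EA`).
-/

namespace Literature.Computability.Complexity

open _root_.Computability Literature.InformationTheory.Entropy Finset

/-! ### Entropy of images of uniform distributions: invariance / additivity rules (aliases) -/

section MapEntropy

variable {ι ι' β β' : Type*} [DecidableEq β] [DecidableEq β']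

/-- **Entropy is invariant under post-composition with a map injective on the outputs**:
if `g (f a) = g (f b) → f a = f b` for `a, b ∈ S` then `H(g(f(U_S))) = H(f(U_S))`.  Alias of
`Literature.InformationTheory.Entropy.mapEntropy_comp_of_injOn`, kept under this name for
importers. [Cover–Thomas, *Elements of Information Theory*, 2nd ed., Problem 2.4; DGRV 2010, §3]
[folklore] -/
theorem mapEntropy_comp_of_injOn {S : Finset ι} (f : ι → β) (g : β → β')
    (hg : ∀ a ∈ S, ∀ b ∈ S, g (f a) = g (f b) → f a = f b) :
    mapEntropy S (g ∘ f) = mapEntropy S f :=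
  Literature.InformationTheory.Entropy.mapEntropy_comp_of_injOn f g hg

/-- **Entropy is invariant under re-indexing the sample space**: for an equivalence
`e : ι' ≃ ι`, `H((f ∘ e)(U_{ι'})) = H(f(U_ι))`.  Alias of
`Literature.InformationTheory.Entropy.mapEntropy_univ_comp_equiv`. [folklore] -/
theorem mapEntropy_univ_comp_equiv [Fintype ι] [Fintype ι'] (e : ι' ≃ ι) (f : ι → β) :
    mapEntropy Finset.univ (f ∘ e) = mapEntropy Finset.univ f :=
  Literature.InformationTheory.Entropy.mapEntropy_univ_comp_equiv e f

/-- **Entropy is additive on independent pairs**: for nonempty `S, T`,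
`H((f × g)(U_{S × T})) = H(f(U_S)) + H(g(U_T))`; the identity `H(Pᵗ) = t · H(P)` behind the
equivalence of the additive gap conventions of `PEA`.  Alias of
`Literature.InformationTheory.Entropy.mapEntropy_product`. [DGRV 2010, §3, p. 6; Cover–Thomas,
2nd ed., Thm 2.6.6] [cite: DvirGutfreundRothblumVadhan2010, §3 p.6] -/
theorem mapEntropy_product {S : Finset ι} {T : Finset ι'} (hS : S.Nonempty) (hT : T.Nonempty)
    (f : ι → β) (g : ι' → β') :
    mapEntropy (S ×ˢ T) (Prod.map f g) = mapEntropy S f + mapEntropy T g :=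
  Literature.InformationTheory.Entropy.mapEntropy_product hS hT f g

/-- The image of a uniform distribution under an injective map is uniform on `|S|` points:
`H(f(U_S)) = log₂ |S|`.  Alias of `Literature.InformationTheory.Entropy.mapEntropy_of_injective`.
[DGRV 2010, Claim 2.2 (flat distributions)] [cite: DvirGutfreundRothblumVadhan2010, Claim 2.2] -/
theorem mapEntropy_of_injective (S : Finset ι) {f : ι → β} (hf : Function.Injective f) :
    mapEntropy S f = Real.logb 2 S.card :=
  Literature.InformationTheory.Entropy.mapEntropy_of_injective S hf

/-- A constant map has output entropy `0`.  Alias of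
`Literature.InformationTheory.Entropy.mapEntropy_const`. [DGRV 2010, Claim 2.2]
[cite: DvirGutfreundRothblumVadhan2010, Claim 2.2] -/
theorem mapEntropy_const (S : Finset ι) (c : β) : mapEntropy S (fun _ : ι => c) = 0 :=
  Literature.InformationTheory.Entropy.mapEntropy_const S c

end MapEntropy

/-! ### Sparse polynomial maps over `F₂` -/

/-- **Sparse presentation of a polynomial map `F₂ⁿ → F₂^m`** (route PneNP/SzkEntropy): a list of
`m` output polynomials, each a list of monomials, each monomial a list of variable indices; the
value of a monomial at `x : Fin n → ZMod 2` is the product of the listed coordinates (empty list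
= the constant monomial `1`; repetitions are harmless since `xᵢ² = xᵢ` on `F₂`-points), and a
polynomial is the sum of its monomials.  An `abbrev` (the route's items quantify over the literal
type `Σ n, List (List (List (Fin n))) × ℕ`). [DGRV 2010, §2 ("polynomial mapping")]
[cite: DvirGutfreundRothblumVadhan2010, §2] -/
abbrev PolyMapF2 (n : ℕ) : Type := List (List (List (Fin n)))

namespace PolyMapF2

variable {n n' : ℕ}

/-- Evaluation of a sparse polynomial map at a point `x ∈ F₂ⁿ`: output `i` is
`∑_{μ ∈ pᵢ} ∏_{j ∈ μ} x_j ∈ ZMod 2`.  (Body fixed by route PneNP/SzkEntropy; do not refactor.)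
[DGRV 2010, §2] [cite: DvirGutfreundRothblumVadhan2010, §2] -/
def eval (P : PolyMapF2 n) (x : Fin n → ZMod 2) : List (ZMod 2) :=
  P.map fun p => (p.map fun μ => (μ.map x).prod).sum

/-- Syntactic degree bound: every monomial of every output polynomial lists at most `d` variable
indices (so the map has degree `≤ d`; conversely every degree-`≤ d` map over `F₂` has such a
presentation by multilinearisation).  Print's class `polynomials_{F₂,d}`.
[DGRV 2010, §3, Def 3.1 (`polynomials_{F,d}`)] [cite: DvirGutfreundRothblumVadhan2010, Def 3.1] -/
def DegLE (d : ℕ) (P : PolyMapF2 n) : Prop :=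
  ∀ p ∈ P, ∀ μ ∈ p, μ.length ≤ d

/-- **Output entropy** `H(P(U_n))`: the Shannon entropy in bits of the output of `P` on a uniformly
random `x ∈ F₂ⁿ` (`mapEntropy` over `Finset.univ`). [DGRV 2010, §1 and Def 2.1 (Shannon entropy,
logarithms base 2)] [cite: DvirGutfreundRothblumVadhan2010, Def 2.1] -/
noncomputable def entropy (P : PolyMapF2 n) : ℝ :=
  mapEntropy Finset.univ P.eval

/-- The Boolean encoding of sparse polynomial maps in `n` variables: variable indices in binary
(`encodingFinBool n`), nested self-delimiting lists. (Fixed by route PneNP/SzkEntropy.)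
[Arora–Barak 2009, §0.1 (representing objects as strings)] [cite: AroraBarak2009, §0.1] -/
def encoding (n : ℕ) : Encoding (PolyMapF2 n) Bool :=
  (encodingFinBool n).listBool.listBool.listBool

/-- The number of outputs of `P.eval x` is the number `m` of output polynomials. [folklore] -/
@[simp] theorem length_eval (P : PolyMapF2 n) (x : Fin n → ZMod 2) : (P.eval x).length = P.length := by
  simp [eval]

/-- The syntactic degree bound is decidable (finite conjunction over the lists). [folklore] -/
instance decidableDegLE (d : ℕ) (P : PolyMapF2 n) : Decidable (P.DegLE d) :=
  inferInstanceAs (Decidable (∀ p ∈ P, ∀ μ ∈ p, μ.length ≤ d))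

/-- The degree bound is monotone in `d`. [folklore] -/
theorem DegLE.mono {d d' : ℕ} {P : PolyMapF2 n} (h : P.DegLE d) (hdd' : d ≤ d') : P.DegLE d' :=
  fun p hp μ hμ => (h p hp μ hμ).trans hdd'

/-- The empty map (no outputs, `m = 0`) has every degree bound. [folklore] -/
theorem degLE_nil (d : ℕ) : DegLE d ([] : PolyMapF2 n) :=
  fun _ hp => absurd hp List.not_mem_nil

/-- The empty map has output entropy `0`. [DGRV 2010, Claim 2.2] [cite: DvirGutfreundRothblumVadhan2010, Claim 2.2] -/
theorem entropy_nil : entropy ([] : PolyMapF2 n) = 0 := by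
  unfold entropy
  have : eval ([] : PolyMapF2 n) = fun _ => [] := by
    funext x
    simp [eval]
  rw [this, mapEntropy_const]

/-- **Direct product** of sparse polynomial maps on disjoint blocks of variables:
`(P.prod Q)(x, x') = (P x, Q x')` for `x ∈ F₂ⁿ`, `x' ∈ F₂^{n'}`, realised on `F₂^{n+n'}` by
re-indexing `P`'s variables along `Fin.castAdd n'` and `Q`'s along `Fin.natAdd n`, and
concatenating the output lists.  Print's `pᵗ(x₁,…,x_t) = (p(x₁),…,p(x_t))` is the iterate.
[DGRV 2010, §3, p. 6] [cite: DvirGutfreundRothblumVadhan2010, §3 p.6] -/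
def prod (P : PolyMapF2 n) (Q : PolyMapF2 n') : PolyMapF2 (n + n') :=
  P.map (List.map (List.map (Fin.castAdd n'))) ++ Q.map (List.map (List.map (Fin.natAdd n)))

/-- The direct product has `m + m'` outputs. [folklore] -/
@[simp] theorem length_prod (P : PolyMapF2 n) (Q : PolyMapF2 n') :
    (P.prod Q).length = P.length + Q.length := by
  simp [prod]

/-- Evaluation of a direct product: evaluate `P` on the first block of coordinates and `Q` on the
second, and concatenate. [DGRV 2010, §3, p. 6] [cite: DvirGutfreundRothblumVadhan2010, §3 p.6] -/
theorem eval_prod (P : PolyMapF2 n) (Q : PolyMapF2 n') (x : Fin (n + n') → ZMod 2) :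
    (P.prod Q).eval x =
      P.eval (fun i => x (Fin.castAdd n' i)) ++ Q.eval (fun j => x (Fin.natAdd n j)) := by
  simp [prod, eval, List.map_map, Function.comp_def]

/-- The degree bound is preserved by direct products. [DGRV 2010, §3, p. 6]
[cite: DvirGutfreundRothblumVadhan2010, §3 p.6] -/
theorem DegLE.prod {d : ℕ} {P : PolyMapF2 n} {Q : PolyMapF2 n'} (hP : P.DegLE d) (hQ : Q.DegLE d) :
    (P.prod Q).DegLE d := by
  intro p hp μ hμ
  simp only [PolyMapF2.prod, List.mem_append, List.mem_map] at hp
  rcases hp with ⟨p₀, hp₀, rfl⟩ | ⟨q₀, hq₀, rfl⟩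
  · obtain ⟨μ₀, hμ₀, rfl⟩ := List.mem_map.1 hμ
    simpa using hP p₀ hp₀ μ₀ hμ₀
  · obtain ⟨μ₀, hμ₀, rfl⟩ := List.mem_map.1 hμ
    simpa using hQ q₀ hq₀ μ₀ hμ₀

/-- **Entropy of a direct product is the sum of the entropies**: `H((P × Q)(U_{n+n'})) =
H(P(U_n)) + H(Q(U_{n'}))`; in particular `H(Pᵗ) = t · H(P)`, the identity used to pass between
additive gap conventions for `PEA`/`PED`. [DGRV 2010, §3, p. 6 ("`H_{uEnt}(Pᵗ) = t · H_{uEnt}(P)`")]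
[cite: DvirGutfreundRothblumVadhan2010, §3 p.6] -/
theorem entropy_prod (P : PolyMapF2 n) (Q : PolyMapF2 n') :
    (P.prod Q).entropy = P.entropy + Q.entropy := by
  have h1 : (P.prod Q).entropy = mapEntropy Finset.univ ((P.prod Q).eval ∘ Fin.appendEquiv n n') :=
    (mapEntropy_univ_comp_equiv (Fin.appendEquiv n n') _).symm
  have h2 : (P.prod Q).eval ∘ Fin.appendEquiv n n' =
      (fun l : List (ZMod 2) × List (ZMod 2) => l.1 ++ l.2) ∘ Prod.map P.eval Q.eval := by
    funext x
    obtain ⟨x₁, x₂⟩ := x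
    simp [eval_prod]
  have h3 : mapEntropy Finset.univ
        ((fun l : List (ZMod 2) × List (ZMod 2) => l.1 ++ l.2) ∘ Prod.map P.eval Q.eval) =
      mapEntropy Finset.univ (Prod.map P.eval Q.eval) := by
    refine mapEntropy_comp_of_injOn _ _ fun a _ b _ h => ?_
    obtain ⟨a₁, a₂⟩ := a
    obtain ⟨b₁, b₂⟩ := b
    simp only [Prod.map_apply] at h ⊢
    obtain ⟨h₁, h₂⟩ := List.append_inj h (by simp)
    rw [h₁, h₂]
  rw [h1, h2, h3, ← Finset.univ_product_univ,
    mapEntropy_product Finset.univ_nonempty Finset.univ_nonempty]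
  rfl

end PolyMapF2

/-! ### The promise problems `PEA_d` and `PED_d` over `F₂` -/

/-- Instances of `PEA`: a number of variables `n`, a sparse polynomial map `p : F₂ⁿ → F₂^m`, and
an integer entropy threshold `k`, as the literal type `Σ n, List (List (List (Fin n))) × ℕ` of
route PneNP/SzkEntropy. [DGRV 2010, §3, p. 6 (instances `(p, k)`)]
[cite: DvirGutfreundRothblumVadhan2010, §3 p.6] -/
abbrev PEAInst : Type := Σ n : ℕ, PolyMapF2 n × ℕ

/-- The Boolean encoding of `PEA` instances: `n` in binary, then the map (`PolyMapF2.encoding n`)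
paired with `k` in binary.  (Fixed by route PneNP/SzkEntropy; do not refactor.)
[Arora–Barak 2009, §0.1] [cite: AroraBarak2009, §0.1] -/
def PEAInst.encoding : Encoding PEAInst Bool :=
  Encoding.sigmaBool fun n => (PolyMapF2.encoding n).pairBool encodingNatBool

/-- **Polynomial Entropy Approximation over `F₂` in degree `d`**, `PEA_d`, Shannon entropy,
integer thresholds with gap `1`: on instances `(p, k)` with `p : F₂ⁿ → F₂^m` sparse of degree
`≤ d` (`DegLE d`), YES iff `H(p(U_n)) ≥ k + 1`, NO iff `H(p(U_n)) ≤ k`.  This is print's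
`PEA^{Shannon,Shannon,+1/2}_{F₂,d}` at the half-integer threshold `k + 1/2` (print: YES
`H ≥ k + c`, NO `H ≤ k - c` for real `k`); all additive-constant gaps are equivalent by direct
products [DGRV, §3 p. 6].  DEFINITIONALLY EQUAL to the `let PEA := …` inlined in the items of
route PneNP/SzkEntropy (e.g. `PEA 3 ∉ PromiseP` is its target).
[DGRV 2010, §3, p. 6 (the promise problem `PEA^{uEnt,ℓEnt,+c}_{F,d}`)]
[cite: DvirGutfreundRothblumVadhan2010, §3 p.6] -/
noncomputable def PEA (d : ℕ) : PromiseProblem :=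
  PromiseProblem.ofEncoding PEAInst.encoding
    {I | PolyMapF2.DegLE d I.2.1 ∧ (I.2.2 : ℝ) + 1 ≤ PolyMapF2.entropy I.2.1}
    {I | PolyMapF2.DegLE d I.2.1 ∧ PolyMapF2.entropy I.2.1 ≤ (I.2.2 : ℝ)}

/-- Instances of `PED`: a pair of sparse polynomial maps `p : F₂ⁿ → F₂^m`, `q : F₂^{n'} → F₂^{m'}`
(each with its own number of variables). [DGRV 2010, Def 3.1–3.2]
[cite: DvirGutfreundRothblumVadhan2010, Def 3.2] -/
abbrev PEDInst : Type := (Σ n : ℕ, PolyMapF2 n) × (Σ n : ℕ, PolyMapF2 n)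

/-- The Boolean encoding of `PED` instances: the pair of the encodings of the two maps (each:
`n` in binary, then `PolyMapF2.encoding n`). [Arora–Barak 2009, §0.1] [cite: AroraBarak2009, §0.1] -/
def PEDInst.encoding : Encoding PEDInst Bool :=
  (Encoding.sigmaBool PolyMapF2.encoding).pairBool (Encoding.sigmaBool PolyMapF2.encoding)

/-- **Polynomial Entropy Difference over `F₂` in degree `d`**, `PED_{F₂,d}` with print's default
parameters (Shannon entropy on both sides, additive gap `1`): on pairs `(p, q)` of sparse maps of
degree `≤ d`, YES iff `H(p(U)) ≥ H(q(U)) + 1`, NO iff `H(p(U)) + 1 ≤ H(q(U))`.  `PED_{F₂,3}` is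
`SZKP_L`-complete [DGRV, Thm 4.7]. [DGRV 2010, Def 3.1 (generalized `ED`) and Def 3.2 (`PED`)]
[cite: DvirGutfreundRothblumVadhan2010, Def 3.2] -/
noncomputable def PED (d : ℕ) : PromiseProblem :=
  PromiseProblem.ofEncoding PEDInst.encoding
    {I | PolyMapF2.DegLE d I.1.2 ∧ PolyMapF2.DegLE d I.2.2 ∧
      PolyMapF2.entropy I.2.2 + 1 ≤ PolyMapF2.entropy I.1.2}
    {I | PolyMapF2.DegLE d I.1.2 ∧ PolyMapF2.DegLE d I.2.2 ∧
      PolyMapF2.entropy I.1.2 + 1 ≤ PolyMapF2.entropy I.2.2}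

/-- Unfolding the yes-instances of `PEA d` on an encoded instance `(n, p, k)`:
`DegLE d p ∧ k + 1 ≤ H(p(U_n))`. [DGRV 2010, §3, p. 6] [cite: DvirGutfreundRothblumVadhan2010, §3 p.6] -/
theorem encode_mem_PEA_yes_iff (d : ℕ) (I : PEAInst) :
    PEAInst.encoding.encode I ∈ (PEA d).yes ↔
      PolyMapF2.DegLE d I.2.1 ∧ (I.2.2 : ℝ) + 1 ≤ PolyMapF2.entropy I.2.1 :=
  PEAInst.encoding.mem_toLanguage_iff _ I

/-- Unfolding the no-instances of `PEA d` on an encoded instance `(n, p, k)`: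
`DegLE d p ∧ H(p(U_n)) ≤ k`. [DGRV 2010, §3, p. 6] [cite: DvirGutfreundRothblumVadhan2010, §3 p.6] -/
theorem encode_mem_PEA_no_iff (d : ℕ) (I : PEAInst) :
    PEAInst.encoding.encode I ∈ (PEA d).no ↔
      PolyMapF2.DegLE d I.2.1 ∧ PolyMapF2.entropy I.2.1 ≤ (I.2.2 : ℝ) :=
  PEAInst.encoding.mem_toLanguage_iff _ I

/-- Unfolding the yes-instances of `PED d` on an encoded pair `(p, q)`:
both of degree `≤ d` and `H(q) + 1 ≤ H(p)`. [DGRV 2010, Def 3.1–3.2] [cite: DvirGutfreundRothblumVadhan2010, Def 3.2] -/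
theorem encode_mem_PED_yes_iff (d : ℕ) (I : PEDInst) :
    PEDInst.encoding.encode I ∈ (PED d).yes ↔
      PolyMapF2.DegLE d I.1.2 ∧ PolyMapF2.DegLE d I.2.2 ∧
        PolyMapF2.entropy I.2.2 + 1 ≤ PolyMapF2.entropy I.1.2 :=
  PEDInst.encoding.mem_toLanguage_iff _ I

/-- Unfolding the no-instances of `PED d` on an encoded pair `(p, q)`:
both of degree `≤ d` and `H(p) + 1 ≤ H(q)`. [DGRV 2010, Def 3.1–3.2] [cite: DvirGutfreundRothblumVadhan2010, Def 3.2] -/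
theorem encode_mem_PED_no_iff (d : ℕ) (I : PEDInst) :
    PEDInst.encoding.encode I ∈ (PED d).no ↔
      PolyMapF2.DegLE d I.1.2 ∧ PolyMapF2.DegLE d I.2.2 ∧
        PolyMapF2.entropy I.1.2 + 1 ≤ PolyMapF2.entropy I.2.2 :=
  PEDInst.encoding.mem_toLanguage_iff _ I

/-- `PEA d` is a disjoint promise problem (`k + 1 ≤ H` and `H ≤ k` are incompatible, and the
encoding is injective). [DGRV 2010, §3 (Def 3.1: "the YES and NO instances do not intersect")]
[cite: DvirGutfreundRothblumVadhan2010, Def 3.1] -/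
theorem PEA_disjoint (d : ℕ) : (PEA d).Disjoint := by
  refine PromiseProblem.disjoint_ofEncoding _ (Set.disjoint_left.2 fun I hY hN => ?_)
  simp only [Set.mem_setOf_eq] at hY hN
  linarith [hY.2, hN.2]

/-- `PED d` is a disjoint promise problem. [DGRV 2010, Def 3.1 ("the YES and NO instances do not
intersect")] [cite: DvirGutfreundRothblumVadhan2010, Def 3.1] -/
theorem PED_disjoint (d : ℕ) : (PED d).Disjoint := by
  refine PromiseProblem.disjoint_ofEncoding _ (Set.disjoint_left.2 fun I hY hN => ?_)
  simp only [Set.mem_setOf_eq] at hY hN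
  linarith [hY.2.2, hN.2.2]

/-- The yes-instances of `PEA d` grow with the degree bound `d`. [DGRV 2010, §3]
[cite: DvirGutfreundRothblumVadhan2010, §3 p.6] -/
theorem PEA_yes_mono {d d' : ℕ} (h : d ≤ d') : (PEA d).yes ≤ (PEA d').yes :=
  PEAInst.encoding.toLanguage_mono fun _ hI => ⟨hI.1.mono h, hI.2⟩

/-- The no-instances of `PEA d` grow with the degree bound `d`. [DGRV 2010, §3]
[cite: DvirGutfreundRothblumVadhan2010, §3 p.6] -/
theorem PEA_no_mono {d d' : ℕ} (h : d ≤ d') : (PEA d).no ≤ (PEA d').no :=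
  PEAInst.encoding.toLanguage_mono fun _ hI => ⟨hI.1.mono h, hI.2⟩

end Literature.Computability.Complexity
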